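import Summits.QuantumFields.YangMills.Theorems.IR.TensionRatioFluxTYLoopBounds
import Summits.QuantumFields.YangMills.Theorems.IR.TensionRatioFluxTYPolyakovBounds
import Summits.QuantumFields.YangMills.Theorems.IR.TensionRatioFluxTYTwistMain
import Summits.QuantumFields.YangMills.Theorems.IR.TensionRatioFluxSeam
import HarnessLib

/-!
# Crux `IR` (stmt-QuantumFields-19354), line `tension-ratio` (flux skeleton): the stub `TYObservable` PROVED —
# Tomboulis–Yaffe's inequality for Wilson loops in an OBSERVABLE centre-charged representation

Pooled prover `ym-ir-line-pool-p3` (gen 3).  Helper module for item `stmt-QuantumFields-19354` (`--supports`; it closes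
nothing).  Assembly of the Tomboulis–Yaffe chain (App. I (A1.3)–(A1.9)) for loops in a probe representation `π` with
`π(z) = ω · 1`, `|ω| = 1`, `ω ≠ 1`, under the Wilson measure of an arbitrary continuous action representation `ρ` on the torus
`(ℤ/L)ᵈ`, `L = 2^(n+1)` — parts `TensionRatioFluxTY{LoopBounds, PolyakovBounds, TwistHelpers, TwistMain}`:

* `polyakovCorrelatorRep_norm_le_twist` — `|⟨tr π(Πⱼ(0)) conj tr π(Πⱼ(s e₀))⟩| ≤ M² ε^{s/L}`, `ε = 8(1 − Z_ρ(z)/Z_ρ(1))/|1−ω|²`;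
* `wilsonLoopRep_abs_le_twist` — `|⟨W^π_{h×w}⟩| ≤ M^{2h/L} ε^{hw/L²}` for dyadic `h, w ≤ L/2`;
* `tyObservable_holds` — VERBATIM the body of the flux skeleton's stub `TYObservable`
  (`Cruxes/IR/Lines/ym_ir7_tension_ratio_flux.lean`, with `Flux.fluxDeficit` of `Theorems/IR/TensionRatioFluxSeam.lean`), so that the
  workfile re-bases by `theorem stub_tyObservable : TYObservable := tyObservable_holds`.

The `π = ρ` instance is the tree's `TomboulisYaffe.wilsonLoop_abs_le_twist` (= `Flux.ty_self`).  HONEST: a reflection-positivity FORMAT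
tool on finite tori (any `β`); it moves no weight off the flux skeleton's loads (T1♭ `ElectricFluxFloor`, T2♭ `RatioFloorDyadic`, XL);
nothing here proves confinement at weak coupling, `IR`, or the YM mass gap (Clay).  [cite: TomboulisYaffe1985, App. I (A1.3)–(A1.9)]
-/

open MeasureTheory Finset Complex
open scoped ComplexOrder ComplexConjugate

noncomputable section

namespace Summit.QuantumFields.YangMills.Cruxes.IR.TensionRatio.FluxTY

open Literature.MathematicalPhysics.QuantumFieldTheory Literature.MathematicalPhysics.QuantumFieldTheory.TomboulisYaffe
open WilsonRP WilsonSiteRP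

variable {d L N M : ℕ} [NeZero d] [NeZero L] {G : Type*} [Group G] [TopologicalSpace G]
  [IsTopologicalGroup G] [CompactSpace G] [MeasurableSpace G] [BorelSpace G]
  (ρ : G →* Matrix (Fin N) (Fin N) ℂ) (π : G →* Matrix (Fin M) (Fin M) ℂ)

/-! ## §1 The assembled chain for `π`-observables -/

section Assembly

/-- Downward induction along a doubling chain: if `a_i² ≤ C |a_{i+1}|` for `i < n` and
`|a_n| ≤ C t^{2^n}` then `|a_i| ≤ C t^{2^i}` for every `i ≤ n` (the iteration behind TY
(A1.3)–(A1.4), (A1.7) and (A1.9): "repeated application … then yields"). [folklore] -/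
private theorem chain_le {a : ℕ → ℝ} {C t : ℝ} (hC : 0 ≤ C) (ht : 0 ≤ t) {n : ℕ}
    (hstep : ∀ i < n, a i ^ 2 ≤ C * |a (i + 1)|) (hlast : |a n| ≤ C * t ^ 2 ^ n) :
    ∀ i ≤ n, |a i| ≤ C * t ^ 2 ^ i := by
  suffices h : ∀ k i, i + k = n → |a i| ≤ C * t ^ 2 ^ i from
    fun i hi => h (n - i) i (by omega)
  intro k
  induction k with
  | zero => intro i hi; rw [add_zero] at hi; subst hi; exact hlast
  | succ k ih =>
    intro i hi
    have h1 := ih (i + 1) (by omega)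
    refine abs_le_of_sq_le_sq ?_ (mul_nonneg hC (pow_nonneg ht _))
    calc a i ^ 2 ≤ C * |a (i + 1)| := hstep i (by omega)
      _ ≤ C * (C * t ^ 2 ^ (i + 1)) := mul_le_mul_of_nonneg_left h1 hC
      _ = (C * t ^ 2 ^ i) ^ 2 := by rw [pow_succ, pow_mul]; ring

/-- **Tomboulis–Yaffe (A1.9) / (2.10): the Polyakov-loop correlator is bounded by a power of the
electric-flux free energy.** Torus `(ℤ/Lℤ)^d` with `L = 2^(n+1)`, compact `G`, continuous
`N`-dimensional `ρ`, any real `β`, a spatial direction `j`, a central `z` with `ρ(z) = ω · 1`,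
`|ω| = 1`, `ω ≠ 1`; `r = Z(z; (0,j))/Z(1; (0,j))` the twist ratio and `ε = 8(1 - r)/|1 - ω|²`. Then
for every separation `s = 2^k ≤ L/2`,
`|⟨tr ρ(Πⱼ(0)) · conj tr ρ(Πⱼ(s e₀))⟩| ≤ N² ε^{s/L}`.
For `SU(2)` (`N = 2`, `ω = -1`, `ε = 2(1 - r) = 4 exp(-F^{elec}/T)`) and normalised traces this is the
printed `G(x) = exp(-F_{qq̄}(x)/T) ≤ (4 exp(-F^{elec}/T))^{x/L_s}`, i.e. (2.10)
`F_{qq̄}(|x - x'|) ≥ |x - x'| (F^{elec} - 2T ln 2)/L_s` for `|x - x'| ≤ L_s/2` (TY state it for all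
such separations on lattices whose sides are powers of two; proved here along the doubling chain
`s = 2^k`, which is what the reflection-positivity iteration gives). Proof as printed: (A1.8) at
`s = L/2` (`polyakovCorrelator_half_normSq_le_twist`) and the Schwarz doubling step
`G(s)² ≤ G(2s)` (`polyakovCorrelator_normSq_le_double`) iterated downwards.
[cite: TomboulisYaffe1985, §II eq. (2.10) and App. I §C eq. (A1.9)] -/
theorem polyakovCorrelatorRep_norm_le_twist (n : ℕ) (hL : L = 2 ^ (n + 1)) (hρ : Continuous ρ) (hπ : Continuous π)
    (β : ℝ) {j : Fin d} (hj : (0 : Fin d) < j) {z : G} (hz : z ∈ Subgroup.center G) {ω : ℂ}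
    (hω : π z = ω • (1 : Matrix (Fin M) (Fin M) ℂ)) (hω1 : ‖ω‖ = 1) (hne : ω ≠ 1)
    (k : ℕ) (hk : k ≤ n) :
    ‖wilsonExpectation ρ β fun U : GaugeConfig d L G =>
        (π (lineHolonomy U j L 0)).trace *
          conj ((π (lineHolonomy U j L ((0 : Site d L) + Pi.single 0 ((2 ^ k : ℕ) : ZMod L)))).trace)‖ ≤
      (M : ℝ) ^ 2 * (8 * (1 - twistedPartitionFunction ρ β L z ⟨(0, j), hj⟩ /
        twistedPartitionFunction ρ β L 1 ⟨(0, j), hj⟩) / ‖1 - ω‖ ^ 2) ^ (((2 ^ k : ℕ) : ℝ) / L) := by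
  have hLe : Even L := ⟨2 ^ n, by rw [hL, pow_succ]; ring⟩
  have hL2 : L / 2 = 2 ^ n := by rw [hL, pow_succ, Nat.mul_div_cancel _ two_pos]
  have hL0 : (L : ℝ) ≠ 0 := Nat.cast_ne_zero.2 (NeZero.ne L)
  have hj0 : j ≠ 0 := fun h => (lt_irrefl (0 : Fin d)) (h ▸ hj)
  set r : ℝ := twistedPartitionFunction ρ β L z ⟨(0, j), hj⟩ /
    twistedPartitionFunction ρ β L 1 ⟨(0, j), hj⟩ with hr
  have hr1 : r ≤ 1 := (div_le_one (twistedPartitionFunction_pos ρ hρ β 1 _)).2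
    (twistedPartitionFunction_le_untwisted_plane ρ β hLe hρ hz _)
  have hω2 : 0 < ‖1 - ω‖ ^ 2 := by
    have : 1 - ω ≠ 0 := sub_ne_zero.2 (Ne.symm hne)
    positivity
  set ε : ℝ := 8 * (1 - r) / ‖1 - ω‖ ^ 2 with hε
  have hε0 : 0 ≤ ε := div_nonneg (by linarith) hω2.le
  have hN0 : (0 : ℝ) ≤ (M : ℝ) ^ 2 := sq_nonneg _
  have key := chain_le (a := fun i => ‖wilsonExpectation ρ β fun U : GaugeConfig d L G =>
      (π (lineHolonomy U j L 0)).trace *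
        conj ((π (lineHolonomy U j L ((0 : Site d L) + Pi.single 0 ((2 ^ i : ℕ) : ZMod L)))).trace)‖)
    (n := n) hN0 (Real.rpow_nonneg hε0 ((1 : ℝ) / L)) ?_ ?_ k hk
  · rw [abs_norm] at key
    refine key.trans (le_of_eq ?_)
    rw [← Real.rpow_mul_natCast hε0]
    congr 2
    push_cast
    field_simp
  · intro i hi
    have hi' : 2 ^ i ≤ L / 2 := by
      rw [hL2]; exact Nat.pow_le_pow_right two_pos (by omega)
    have h := (polyakovCorrelatorRep_normSq_le_double ρ π hLe hρ hπ β hj0 (2 ^ i) hi').2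
    rw [show 2 * 2 ^ i = 2 ^ (i + 1) by ring] at h
    rw [abs_norm]
    exact h.trans (mul_le_mul_of_nonneg_left (Complex.re_le_norm _) hN0)
  · have h := polyakovCorrelatorRep_half_normSq_le_twist ρ π hLe hρ hπ β hj hz hω hω1
    rw [hL2] at h
    set X : ℂ := wilsonExpectation ρ β fun U : GaugeConfig d L G =>
      (π (lineHolonomy U j L 0)).trace *
        conj ((π (lineHolonomy U j L ((0 : Site d L) + Pi.single 0 ((2 ^ n : ℕ) : ZMod L)))).trace)
      with hX
    have hpow : (ε ^ ((1 : ℝ) / L)) ^ 2 ^ n = Real.sqrt ε := by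
      rw [← Real.rpow_mul_natCast hε0, Real.sqrt_eq_rpow]
      congr 1
      rw [hL]
      push_cast
      field_simp
      ring
    refine abs_le_of_sq_le_sq ?_ (mul_nonneg hN0 (pow_nonneg (Real.rpow_nonneg hε0 _) _))
    calc ‖X‖ ^ 2 = ‖1 - ω‖ ^ 2 * ‖X‖ ^ 2 / ‖1 - ω‖ ^ 2 := (mul_div_cancel_left₀ _ hω2.ne').symm
      _ ≤ 8 * (M : ℝ) ^ 4 * (1 - r) / ‖1 - ω‖ ^ 2 := div_le_div_of_nonneg_right h hω2.le
      _ = ((M : ℝ) ^ 2 * (ε ^ ((1 : ℝ) / L)) ^ 2 ^ n) ^ 2 := by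
        rw [hpow, mul_pow, Real.sq_sqrt hε0, hε]
        ring

/-- **Tomboulis–Yaffe, Wilson-loop form: Wilson loops are bounded by the electric-flux free
energy.** Same setting (`L = 2^(n+1)`, `ε = 8(1 - r)/|1 - ω|²`, `r = Z(z; (0,j))/Z(1; (0,j))`). For
the rectangular Wilson loop with `h = 2^a ≤ L/2` links in the time direction `0` and `w = 2^b ≤ L/2`
links in the spatial direction `j` (normalised trace, `wilsonLoop`):
`|⟨W_{h×w}⟩| ≤ N^{2h/L} · ε^{hw/L²}`.
This is the chain of Appendix I as printed: (A1.3)–(A1.4) (`W_{I,J}² ≤ W_{2I,J}`, iterated: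
`wilsonLoop_sq_le_double`), (A1.6)–(A1.7) (`W_{L_t/2,J}² ≤` Polyakov-loop correlator:
`wilsonLoop_half_sq_le_polyakovCorrelator`, `polyakovCorrelator_swap`), then (A1.9) and (A1.8)
(`polyakovCorrelator_norm_le_twist`); the factor `N^{2h/L}` is the torus form of TY's "factors of
two [replaced] by the dimension of the fundamental representation". (The Wilson-loop corollary
`W(C) ≤ const · (exp(-F_el/T))^{A/(L_μL_ν)}` is how Kovács–Tomboulis (2002) eq. (2.6) and Kanazawa
(2009) Thm 1–2 quote TY.) [cite: TomboulisYaffe1985, App. I eqs. (A1.3)–(A1.9)] -/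
theorem wilsonLoopRep_abs_le_twist (n : ℕ) (hL : L = 2 ^ (n + 1)) (hρ : Continuous ρ) (hπ : Continuous π) (β : ℝ)
    {j : Fin d} (hj : (0 : Fin d) < j) {z : G} (hz : z ∈ Subgroup.center G) {ω : ℂ}
    (hω : π z = ω • (1 : Matrix (Fin M) (Fin M) ℂ)) (hω1 : ‖ω‖ = 1) (hne : ω ≠ 1)
    (a b : ℕ) (ha : a ≤ n) (hb : b ≤ n) :
    |wilsonExpectation ρ β (wilsonLoop π (0 : Site d L) 0 j (2 ^ a) (2 ^ b))| ≤
      (M : ℝ) ^ (((2 * 2 ^ a : ℕ) : ℝ) / L) *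
        (8 * (1 - twistedPartitionFunction ρ β L z ⟨(0, j), hj⟩ /
          twistedPartitionFunction ρ β L 1 ⟨(0, j), hj⟩) / ‖1 - ω‖ ^ 2) ^
            (((2 ^ a * 2 ^ b : ℕ) : ℝ) / (L : ℝ) ^ 2) := by
  have hLe : Even L := ⟨2 ^ n, by rw [hL, pow_succ]; ring⟩
  have hL2 : L / 2 = 2 ^ n := by rw [hL, pow_succ, Nat.mul_div_cancel _ two_pos]
  have hL0 : (L : ℝ) ≠ 0 := Nat.cast_ne_zero.2 (NeZero.ne L)
  have hj0 : j ≠ 0 := fun h => (lt_irrefl (0 : Fin d)) (h ▸ hj)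
  set r : ℝ := twistedPartitionFunction ρ β L z ⟨(0, j), hj⟩ /
    twistedPartitionFunction ρ β L 1 ⟨(0, j), hj⟩ with hr
  have hr1 : r ≤ 1 := (div_le_one (twistedPartitionFunction_pos ρ hρ β 1 _)).2
    (twistedPartitionFunction_le_untwisted_plane ρ β hLe hρ hz _)
  have hω2 : 0 < ‖1 - ω‖ ^ 2 := by
    have : 1 - ω ≠ 0 := sub_ne_zero.2 (Ne.symm hne)
    positivity
  set ε : ℝ := 8 * (1 - r) / ‖1 - ω‖ ^ 2 with hε
  have hε0 : 0 ≤ ε := div_nonneg (by linarith) hω2.le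
  have hN0 : (0 : ℝ) ≤ (M : ℝ) := Nat.cast_nonneg _
  -- the base of the chain in the time extent: `t = N^{2/L} ε^{w/L²}`
  have ht0 : (0 : ℝ) ≤ (M : ℝ) ^ ((2 : ℝ) / L) * ε ^ (((2 ^ b : ℕ) : ℝ) / (L : ℝ) ^ 2) :=
    mul_nonneg (Real.rpow_nonneg hN0 _) (Real.rpow_nonneg hε0 _)
  have key := chain_le
    (a := fun i => wilsonExpectation ρ β (wilsonLoop π (0 : Site d L) 0 j (2 ^ i) (2 ^ b)))
    (n := n) zero_le_one ht0 ?_ ?_ a ha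
  · rw [one_mul] at key
    refine key.trans (le_of_eq ?_)
    rw [mul_pow, ← Real.rpow_mul_natCast hN0, ← Real.rpow_mul_natCast hε0]
    congr 2
    · push_cast; ring
    · push_cast; ring
  · intro i hi
    have hi' : 2 ^ i ≤ L / 2 := by
      rw [hL2]; exact Nat.pow_le_pow_right two_pos (by omega)
    have h := (wilsonLoopRep_sq_le_double ρ π hLe hρ hπ β hj0 (2 ^ i) (2 ^ b) hi').2
    rw [show 2 * 2 ^ i = 2 ^ (i + 1) by ring] at h
    rw [one_mul]
    exact h.trans (le_abs_self _)
  · rw [one_mul]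
    have h1 := wilsonLoopRep_half_sq_le_polyakovCorrelator ρ π hLe hρ hπ β hj0 (2 ^ b)
    rw [hL2, polyakovCorrelatorRep_swap ρ π hρ β j (2 ^ b)] at h1
    have h2 := polyakovCorrelatorRep_norm_le_twist ρ π n hL hρ hπ β hj hz hω hω1 hne b hb
    rw [← hr, ← hε] at h2
    refine abs_le_of_sq_le_sq ?_ (pow_nonneg ht0 _)
    calc (wilsonExpectation ρ β (wilsonLoop π (0 : Site d L) 0 j (2 ^ n) (2 ^ b))) ^ 2
        ≤ _ := h1
      _ ≤ _ := Complex.re_le_norm _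
      _ ≤ (M : ℝ) ^ 2 * ε ^ (((2 ^ b : ℕ) : ℝ) / L) := by exact_mod_cast h2
      _ = (((M : ℝ) ^ ((2 : ℝ) / L) * ε ^ (((2 ^ b : ℕ) : ℝ) / (L : ℝ) ^ 2)) ^ 2 ^ n) ^ 2 := by
        rw [← pow_mul, show 2 ^ n * 2 = L by rw [hL, pow_succ], mul_pow,
          ← Real.rpow_mul_natCast hN0, ← Real.rpow_mul_natCast hε0, ← Real.rpow_two]
        congr 2
        · field_simp
        · push_cast; field_simp

end Assembly

/-! ## §2 The flux skeleton's stub `TYObservable`, verbatim -/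

/-- **`TYObservable` PROVED** — verbatim the body of the stub of `Cruxes/IR/Lines/ym_ir7_tension_ratio_flux.lean`: Tomboulis–Yaffe
App. I with the Wilson loops and Polyakov lines in a centre-charged continuous representation `π` (`π z = ω·1`, `‖ω‖ = 1`, `ω ≠ 1`)
while the twist sits in the `ρ`-action: `|⟨W^π_{2^a×2^b}⟩_{L,β}| ≤ M^{2·2^a∕L} · (8·fluxDeficit_ρ(z)∕‖1−ω‖²)^{2^a 2^b∕L²}` on the torus of
side `L = 2^(n+1)`, `a, b ≤ n`. -/
theorem tyObservable_holds :
    ∀ (d L N M : ℕ) [NeZero d] [NeZero L] (G : Type) [Group G] [TopologicalSpace G] [IsTopologicalGroup G] [CompactSpace G]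
      [MeasurableSpace G] [BorelSpace G] (ρ : G →* Matrix (Fin N) (Fin N) ℂ) (π : G →* Matrix (Fin M) (Fin M) ℂ),
      Continuous ρ → Continuous π → ∀ n : ℕ, L = 2 ^ (n + 1) → ∀ (β : ℝ) (j : Fin d) (hj : (0 : Fin d) < j) (z : G),
        z ∈ Subgroup.center G → ∀ ω : ℂ, π z = ω • (1 : Matrix (Fin M) (Fin M) ℂ) → ‖ω‖ = 1 → ω ≠ 1 →
          ∀ a b : ℕ, a ≤ n → b ≤ n →
            |wilsonExpectation ρ β (wilsonLoop π (0 : Site d L) 0 j (2 ^ a) (2 ^ b))| ≤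
              (M : ℝ) ^ (((2 * 2 ^ a : ℕ) : ℝ) / L) *
                (8 * Flux.fluxDeficit ρ β L z ⟨(0, j), hj⟩ / ‖1 - ω‖ ^ 2) ^ (((2 ^ a * 2 ^ b : ℕ) : ℝ) / (L : ℝ) ^ 2) := by
  intro d L N M _ _ G _ _ _ _ _ _ ρ π hρ hπ n hL β j hj z hz ω hω hω1 hne a b ha hb
  exact wilsonLoopRep_abs_le_twist ρ π n hL hρ hπ β hj hz hω hω1 hne a b ha hb

end Summit.QuantumFields.YangMills.Cruxes.IR.TensionRatio.FluxTY

end
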